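import Literature.AnabelianGeometry.EtaleTheta.Thm16SubdagCompanion
import Literature.AnabelianGeometry.EtaleTheta.Thm16SubdagStatements
import HarnessLib

/-!
# [EtTh] Theorem 1.6 (i): the assembly from its printed inputs (sub-DAG `EtTh:Thm1.6`, part 4 —
# row L00(i) with leaf L05 transported; leaf L04 enters BY NAME as an iff-hypothesis)

Mochizuki, *The étale theta function …*, Publ. RIMS **45** (2009), Thm. 1.6 (i), PRIMS PDF p. 24
(printed 250); constructions of §1 pp. 12–13, 17 [cite: MochizukiEtTh2009, Thm 1.6 p.24]. abc-iut
cell, layer L2, D-0068 (1) sub-DAG (index `plan/L2/SUBDAG-EtTh-Thm16.md`; seat abc-iut-L6-d5, §K row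
K3). PROOF-ONLY companion of `Thm16SubdagCompanion.lean` / `Thm16SubdagStatements.lean` (same seat)
and of abc-iut-L2-t1's `TemperedRigidity.lean` (`ThetaSetting.Thm16i`); nothing there is edited.

Printed proof of (i), p. 24: "Assertion (i) is immediate from the definitions; the discreteness of
the topological group “Z”; and the fact that γ maps Δ^tp_{Xα} onto Δ^tp_{Xβ} [cf. [Mzk2], Lemma 1.3.8]
and preserves decomposition groups of cusps [cf. [Mzk14], Theorem 6.5, (iii)]."

PROVED here:
* `Thm16Sub.ellCompanion (hΔ) : (Π^tp_{Xα})^ell ≃* (Π^tp_{Xβ})^ell`, compatible with `γ` (the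
  ell-analogue of `algCompanion`; "γ maps Δ^tp_{Xα} onto Δ^tp_{Xβ}" ⟹ γ respects `Π^tp ↠ (Π^tp)^ell`);
* `Thm16Sub.map_DtpY_eq`, `map_ellPowersY_eq` — γ carries `Δ^tp_Y` and `N·(Δ^tp_Y)^ell` across;
* `Thm16Sub.map_GtpYN_eq_of_inputs` — **`γ(Π^tp_{Y_N,α}) = Π^tp_{Y_N,β}`** from EXACTLY: (hΔ)
  ([AbsAnab] Lem. 1.3.8), `γ(Π^tp_{Yα}) = Π^tp_{Yβ}` (leaf L02), the transport of the condition
  "aug(g) ∈ G_{K_N}" (leaf L04 — the row of abc-iut-w5-d051, here the iff-hypothesis `haugN`), the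
  printed construction of `Y_N` from a cusp section on both sides (leaf L05, `GtpYNFromCusp`),
  [SemiAnbd] Thm. 6.5 (iii) ("preserves decomposition groups of cusps",
  `TemperedCurve.IsoPreservesCuspidalDecomp`, leaf L03) and the existence of a cuspidal decomposition
  group inside `Π^tp_{Yα}`;
* `Thm16Sub.thm16i_of_inputs`, `thm16i_of_inputs'` — Theorem 1.6 (i) `ThetaSetting.Thm16i γ` from
  the same inputs at `N = 2` (`Ÿ = Y₂`), the primed form taking leaf L02 through
  `KerToZIsCompactlyGenerated` on both sides.
No definition of a `Prop`; no new fact. HONEST FRAMING: [EtTh] is refereed and undisputed; the leaf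
statements L02/L04/L05 remain sub-DAG TARGETS (hypotheses here), typed ≠ proved; nothing here takes a
side on [IUTchIII] Cor. 3.12.
-/

noncomputable section

namespace Literature.AnabelianGeometry.EtaleTheta

open Literature.AnabelianGeometry.SemiGraphs

namespace Thm16Sub

variable {p : ℕ} [Fact p.Prime] (Dα Dβ : ThetaSetting p) (γ : Dα.PiTemp ≃ₜ* Dβ.PiTemp)
  (hΔ : Dα.DeltaTemp.map γ.toMulEquiv.toMonoidHom = Dβ.DeltaTemp)

/-! ### The ell companion of `γ` -/

/-- `Π^tp_X ↠ (Π^tp_X)^ell` is surjective (p. 12). [cite: MochizukiEtTh2009, §1 p.12] -/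
theorem toEll_surjective (D : ThetaSetting p) : Function.Surjective (toEll D) :=
  D.thetaToEll_surjective.comp D.toTheta_surjective

include hΔ in
/-- `Ker((·)^ell_α) ≤ Ker((·)^ell_β ∘ γ)`. [cite: MochizukiEtTh2009, Thm 1.6 (ii) p.24] -/
theorem kerEll_le_ker_comp :
    (toEll Dα).ker ≤ ((toEll Dβ).comp γ.toMulEquiv.toMonoidHom).ker := by
  intro x hx
  have : γ.toMulEquiv x ∈ (toEll Dβ).ker := by
    rw [← map_ker_toEll_eq Dα Dβ γ hΔ]; exact ⟨x, hx, rfl⟩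
  exact this

/-- The forward map `(Π^tp_{Xα})^ell → (Π^tp_{Xβ})^ell` induced by `γ`. [cite: MochizukiEtTh2009, Thm 1.6 (ii) p.24] -/
def ellCompanionHom : Dα.GtpEll →* Dβ.GtpEll :=
  (toEll Dα).liftOfSurjective (toEll_surjective Dα)
    ⟨(toEll Dβ).comp γ.toMulEquiv.toMonoidHom, kerEll_le_ker_comp Dα Dβ γ hΔ⟩

/-- The forward ell map on elements. [cite: MochizukiEtTh2009, Thm 1.6 (ii) p.24] -/
theorem ellCompanionHom_apply (x : Dα.PiTemp) :
    ellCompanionHom Dα Dβ γ hΔ (toEll Dα x) = toEll Dβ (γ.toMulEquiv x) :=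
  (toEll Dα).liftOfRightInverse_comp_apply _ _ _ x

/-- The backward ell map inverts the forward one. [cite: MochizukiEtTh2009, Thm 1.6 (ii) p.24] -/
theorem ellCompanionHom_symm_comp (g : Dα.GtpEll) :
    ellCompanionHom Dβ Dα γ.symm (hΔ_symm Dα Dβ γ hΔ) (ellCompanionHom Dα Dβ γ hΔ g) = g := by
  obtain ⟨x, rfl⟩ := toEll_surjective Dα g
  rw [ellCompanionHom_apply, ellCompanionHom_apply]
  exact congrArg (toEll Dα) (γ.symm_apply_apply x)

/-- **The ell companion** `(Π^tp_{Xα})^ell ⥲ (Π^tp_{Xβ})^ell` of `γ`, granted (hΔ).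
[cite: MochizukiEtTh2009, Thm 1.6 (ii) p.24] -/
def ellCompanion : Dα.GtpEll ≃* Dβ.GtpEll :=
  MonoidHom.toMulEquiv (ellCompanionHom Dα Dβ γ hΔ) (ellCompanionHom Dβ Dα γ.symm (hΔ_symm Dα Dβ γ hΔ))
    (MonoidHom.ext fun g => ellCompanionHom_symm_comp Dα Dβ γ hΔ g)
    (MonoidHom.ext fun g => by
      obtain ⟨y, rfl⟩ := toEll_surjective Dβ g
      change ellCompanionHom Dα Dβ γ hΔ (ellCompanionHom Dβ Dα γ.symm (hΔ_symm Dα Dβ γ hΔ) (toEll Dβ y)) =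
        toEll Dβ y
      rw [ellCompanionHom_apply, ellCompanionHom_apply]
      exact congrArg (toEll Dβ) (γ.apply_symm_apply y))

/-- `γ^ell ∘ (·)^ell = (·)^ell ∘ γ` on elements. [cite: MochizukiEtTh2009, Thm 1.6 (ii) p.24] -/
theorem ellCompanion_apply_toEll (x : Dα.PiTemp) :
    ellCompanion Dα Dβ γ hΔ (toEll Dα x) = toEll Dβ (γ.toMulEquiv x) :=
  ellCompanionHom_apply Dα Dβ γ hΔ x

/-- … and on subgroups: `γ^ell(H^ell) = (γ H)^ell`. [cite: MochizukiEtTh2009, Thm 1.6 (ii) p.24] -/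
theorem map_ellCompanion_map_toEll (H : Subgroup Dα.PiTemp) :
    (H.map (toEll Dα)).map (ellCompanion Dα Dβ γ hΔ).toMonoidHom =
      (H.map γ.toMulEquiv.toMonoidHom).map (toEll Dβ) := by
  rw [Subgroup.map_map, Subgroup.map_map]
  congr 1
  ext x
  exact ellCompanion_apply_toEll Dα Dβ γ hΔ x

/-- Membership transport: `(γ x)^ell ∈ γ^ell(S)` iff `x^ell ∈ S`. [cite: MochizukiEtTh2009, Thm 1.6 (ii) p.24] -/
theorem toEll_mem_map_iff (S : Subgroup Dα.GtpEll) (x : Dα.PiTemp) :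
    toEll Dβ (γ.toMulEquiv x) ∈ S.map (ellCompanion Dα Dβ γ hΔ).toMonoidHom ↔ toEll Dα x ∈ S := by
  rw [← ellCompanion_apply_toEll Dα Dβ γ hΔ x]
  constructor
  · rintro ⟨s, hs, hsx⟩
    rwa [← (ellCompanion Dα Dβ γ hΔ).injective hsx]
  · intro hx
    exact ⟨toEll Dα x, hx, rfl⟩

/-! ### Transport of `Δ^tp_Y` and of `N·(Δ^tp_Y)^ell` -/

include hΔ in
/-- `γ(Δ^tp_{Yα}) = Δ^tp_{Yβ}` once `γ(Π^tp_{Yα}) = Π^tp_{Yβ}`. [cite: MochizukiEtTh2009, Thm 1.6 (i) p.24] -/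
theorem map_DtpY_eq (hY : Dα.GtpY.map γ.toMulEquiv.toMonoidHom = Dβ.GtpY) :
    Dα.DtpY.map γ.toMulEquiv.toMonoidHom = Dβ.DtpY := by
  change (Dα.GtpY ⊓ Dα.DeltaTemp).map γ.toMulEquiv.toMonoidHom = Dβ.GtpY ⊓ Dβ.DeltaTemp
  ext y
  constructor
  · rintro ⟨x, ⟨hxY, hxΔ⟩, rfl⟩
    exact ⟨hY ▸ ⟨x, hxY, rfl⟩, hΔ ▸ ⟨x, hxΔ, rfl⟩⟩
  · rintro ⟨hyY, hyΔ⟩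
    rw [← hY] at hyY
    obtain ⟨x, hx, rfl⟩ := hyY
    rw [← hΔ] at hyΔ
    obtain ⟨x', hx', h⟩ := hyΔ
    have hxx : x' = x := γ.toMulEquiv.injective h
    subst hxx
    exact ⟨x', ⟨hx, hx'⟩, rfl⟩

include hΔ in
/-- `γ^ell(N·(Δ^tp_{Yα})^ell) = N·(Δ^tp_{Yβ})^ell`. [cite: MochizukiEtTh2009, §1 p.13] -/
theorem map_ellPowersY_eq (hY : Dα.GtpY.map γ.toMulEquiv.toMonoidHom = Dβ.GtpY) (N : ℕ+) :
    (ellPowersY Dα N).map (ellCompanion Dα Dβ γ hΔ).toMonoidHom = ellPowersY Dβ N := by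
  rw [ellPowersY, ellPowersY, MonoidHom.map_closure, ← Set.image_comp]
  congr 1
  have hpow : ((ellCompanion Dα Dβ γ hΔ).toMonoidHom : Dα.GtpEll → Dβ.GtpEll) ∘
      (fun y : Dα.GtpEll => y ^ (N : ℕ)) =
      (fun y : Dβ.GtpEll => y ^ (N : ℕ)) ∘ (ellCompanion Dα Dβ γ hΔ).toMonoidHom := by
    funext y
    simp
  rw [hpow, Set.image_comp]
  congr 1
  have h := map_ellCompanion_map_toEll Dα Dβ γ hΔ Dα.DtpY
  rw [map_DtpY_eq Dα Dβ γ hΔ hY] at h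
  exact congrArg SetLike.coe h

/-! ### Row L00(i): `γ(Π^tp_{Y_N,α}) = Π^tp_{Y_N,β}` from the printed inputs -/

include hΔ in
/-- **`γ(Π^tp_{Y_N,α}) = Π^tp_{Y_N,β}`** from: (hΔ); `γ(Π^tp_{Yα}) = Π^tp_{Yβ}` (leaf L02); the
transported `G_{K_N}`-condition `haugN` (leaf L04, group-theoretic via "G_{K_N} acts trivially on
(Δ^tp_X)^ell/N·(Δ^tp_Y)^ell", p. 13); the construction of `Y_N` from a cusp section on both sides
(leaf L05); "γ … preserves decomposition groups of cusps [cf. [Mzk14], Theorem 6.5, (iii)]"; and a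
cuspidal decomposition group inside `Π^tp_{Yα}` (cusps of `X` lie on the irreducible component).
[cite: MochizukiEtTh2009, Thm 1.6 (i) p.24] -/
theorem map_GtpYN_eq_of_inputs (N : ℕ+) (hY : Dα.GtpY.map γ.toMulEquiv.toMonoidHom = Dβ.GtpY)
    (haugN : ∀ g : Dα.PiTemp, Dβ.aug (γ.toMulEquiv g) ∈ Dβ.GKN N ↔ Dα.aug g ∈ Dα.GKN N)
    (hcuspα : GtpYNFromCusp Dα N) (hcuspβ : GtpYNFromCusp Dβ N)
    (h65 : Dα.IsoPreservesCuspidalDecomp Dβ.toTemperedCurve)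
    (hex : ∃ Dc : Subgroup Dα.PiTemp, Dα.IsCuspidalDecompositionGroup Dc ∧ Dc ≤ Dα.GtpY) :
    (Dα.GtpYN N).map γ.toMulEquiv.toMonoidHom = Dβ.GtpYN N := by
  obtain ⟨Dc, hDc, hDcY⟩ := hex
  -- the transported cuspidal decomposition group
  have hDc' : Dβ.IsCuspidalDecompositionGroup (Dc.map γ.toMulEquiv.toMonoidHom) := ((h65 γ Dc).1 hDc)
  have hDcY' : Dc.map γ.toMulEquiv.toMonoidHom ≤ Dβ.GtpY := by
    rw [← hY]; exact Subgroup.map_mono hDcY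
  -- transport of the auxiliary subgroup `(Dc ⊓ aug⁻¹ G_{K_N})^ell ⊔ N·(Δ^tp_Y)^ell`
  have haux : (Dc ⊓ (Dα.GKN N).comap Dα.aug.toMonoidHom).map γ.toMulEquiv.toMonoidHom =
      Dc.map γ.toMulEquiv.toMonoidHom ⊓ (Dβ.GKN N).comap Dβ.aug.toMonoidHom := by
    ext y
    constructor
    · rintro ⟨x, ⟨hxD, hxK⟩, rfl⟩
      exact ⟨⟨x, hxD, rfl⟩, (haugN x).2 hxK⟩
    · rintro ⟨⟨x, hxD, rfl⟩, hyK⟩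
      exact ⟨x, ⟨hxD, (haugN x).1 hyK⟩, rfl⟩
  have hT : ((((Dc ⊓ (Dα.GKN N).comap Dα.aug.toMonoidHom).map (toEll Dα)) ⊔ ellPowersY Dα N).map
        (ellCompanion Dα Dβ γ hΔ).toMonoidHom) =
      ((Dc.map γ.toMulEquiv.toMonoidHom ⊓ (Dβ.GKN N).comap Dβ.aug.toMonoidHom).map (toEll Dβ)) ⊔
        ellPowersY Dβ N := by
    rw [Subgroup.map_sup, map_ellCompanion_map_toEll, haux, map_ellPowersY_eq Dα Dβ γ hΔ hY N]
  ext y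
  obtain ⟨x, rfl⟩ := γ.toMulEquiv.surjective y
  have hmem : γ.toMulEquiv x ∈ (Dα.GtpYN N).map γ.toMulEquiv.toMonoidHom ↔ x ∈ Dα.GtpYN N := by
    constructor
    · rintro ⟨x', hx', h⟩
      rwa [← γ.toMulEquiv.injective h]
    · exact fun hx => ⟨x, hx, rfl⟩
  rw [hmem, hcuspα Dc hDc hDcY x, hcuspβ _ hDc' hDcY' (γ.toMulEquiv x), ← hT,
    toEll_mem_map_iff Dα Dβ γ hΔ, ← haugN x]
  have hYx : γ.toMulEquiv x ∈ Dβ.GtpY ↔ x ∈ Dα.GtpY := by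
    rw [← hY]
    constructor
    · rintro ⟨x', hx', h⟩
      rwa [← γ.toMulEquiv.injective h]
    · exact fun hx => ⟨x, hx, rfl⟩
  rw [hYx]

include hΔ in
/-- **Theorem 1.6 (i) from its printed inputs** (`Ÿ = Y₂`): `ThetaSetting.Thm16i γ` ⟸ (hΔ) +
leaf L02 + leaf L04 (`haugN` at `N = 2`) + leaf L05 on both sides + [SemiAnbd] Thm. 6.5 (iii) + a
cuspidal decomposition group in `Π^tp_{Yα}`. [cite: MochizukiEtTh2009, Thm 1.6 (i) p.24] -/
theorem thm16i_of_inputs (hY : Dα.GtpY.map γ.toMulEquiv.toMonoidHom = Dβ.GtpY)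
    (haug2 : ∀ g : Dα.PiTemp, Dβ.aug (γ.toMulEquiv g) ∈ Dβ.GKN 2 ↔ Dα.aug g ∈ Dα.GKN 2)
    (hcuspα : GtpYNFromCusp Dα 2) (hcuspβ : GtpYNFromCusp Dβ 2)
    (h65 : Dα.IsoPreservesCuspidalDecomp Dβ.toTemperedCurve)
    (hex : ∃ Dc : Subgroup Dα.PiTemp, Dα.IsCuspidalDecompositionGroup Dc ∧ Dc ≤ Dα.GtpY) :
    ThetaSetting.Thm16i γ :=
  thm16i_of_map_GtpYN_two γ (map_GtpYN_eq_of_inputs Dα Dβ γ hΔ 2 hY haug2 hcuspα hcuspβ h65 hex)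

include hΔ in
/-- The same with leaf L02 discharged through the printed definition of `Z` on both sides
(`KerToZIsCompactlyGenerated`, `map_GtpY_eq_of_kerToZ`). [cite: MochizukiEtTh2009, Thm 1.6 (i) p.24] -/
theorem thm16i_of_inputs' (hZα : KerToZIsCompactlyGenerated Dα) (hZβ : KerToZIsCompactlyGenerated Dβ)
    (haug2 : ∀ g : Dα.PiTemp, Dβ.aug (γ.toMulEquiv g) ∈ Dβ.GKN 2 ↔ Dα.aug g ∈ Dα.GKN 2)
    (hcuspα : GtpYNFromCusp Dα 2) (hcuspβ : GtpYNFromCusp Dβ 2)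
    (h65 : Dα.IsoPreservesCuspidalDecomp Dβ.toTemperedCurve)
    (hex : ∃ Dc : Subgroup Dα.PiTemp, Dα.IsCuspidalDecompositionGroup Dc ∧ Dc ≤ Dα.GtpY) :
    ThetaSetting.Thm16i γ :=
  thm16i_of_inputs Dα Dβ γ hΔ (map_GtpY_eq_of_kerToZ γ hZα hZβ) haug2 hcuspα hcuspβ h65 hex

end Thm16Sub

end Literature.AnabelianGeometry.EtaleTheta

end
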